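import Mathlib
import HarnessLib
import Summits.ValiantsHypothesis.ValiantsHypothesis.Theorems.MonotoneRestorationOrbitRestorationLinearVolumeQPSeparatingFamily

/-!
# The route's kill constructions are irrefutable short of VP ≠ VNP

Route MonotoneRestoration.  The counting-width kill constructions — `PolylogWidthVP` (for the binder L1 /
`OrbitRestorationQP`, `Theorems/MonotoneRestorationQP/Negative/OrbitRestorationFalseOfPolylogWidthVP.lean`) and its
R1-class form `LinearVolumePolylogWidthVP` (`Theorems/OrbitRestorationLinearVolumeQP/Negative/…`) — EXIST under
`VP = VNP`, by the unconditional separating `VNP` pattern family of `…LinearVolumeQPSeparatingFamily.lean`.  Hence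
refuting either construction proves Valiant's hypothesis:

* `polylogWidthVP_of_VP_eq_VNP : VP ℂ = VNP ℂ → PolylogWidthVP`;
* `valiantsHypothesis_of_not_linearVolumePolylogWidthVP : ¬ LinearVolumePolylogWidthVP → ValiantsHypothesis`;
* `valiantsHypothesis_of_not_polylogWidthVP : ¬ PolylogWidthVP → ValiantsHypothesis`.

Reading for the planners: the negative lemmas `H → ¬ L1` / `H → ¬ R1` have constructions `H` with `¬H ⇒ VH`; the
dichotomy "prove the crux or build H" is therefore exactly as hard as VH on BOTH sides (no cheap refutation of H).
Honest framing: two-line corollaries; nothing is proved about VP ≠ VNP.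
-/

noncomputable section

-- `Summit.ValiantsHypothesis.ValiantsHypothesis.…` is the tree's single-conjunct layout (Sub = Summit).
set_option linter.dupNamespace false

namespace Summit.ValiantsHypothesis.ValiantsHypothesis.Theorems

namespace OrbitRestorationLinearVolumeQPVHStrength

open Literature.Computability.AlgebraicComplexity

/-- Under `VP = VNP` the route's kill construction `PolylogWidthVP` (a polylog-separating matrix-symmetric `VP` family)
exists. [cite: DawarWilsenach2025, Thm 7.2] -/
theorem polylogWidthVP_of_VP_eq_VNP (hEq : VP ℂ = VNP ℂ) : PolylogWidthVP :=
  polylogWidthVP_of_linearVolumePolylogWidthVP (linearVolumePolylogWidthVP_of_VP_eq_VNP hEq)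

/-- **Refuting the R1-class kill construction proves VH**: `¬ LinearVolumePolylogWidthVP → VP ≠ VNP`.
[cite: DawarWilsenach2025, Thm 7.2] -/
theorem valiantsHypothesis_of_not_linearVolumePolylogWidthVP (h : ¬ LinearVolumePolylogWidthVP) :
    ValiantsHypothesis := by
  show VP ℂ ≠ VNP ℂ
  exact fun hEq => h (linearVolumePolylogWidthVP_of_VP_eq_VNP hEq)

/-- **Refuting the route's kill construction proves VH**: `¬ PolylogWidthVP → VP ≠ VNP`. [cite: DawarWilsenach2025, Thm 7.2] -/
theorem valiantsHypothesis_of_not_polylogWidthVP (h : ¬ PolylogWidthVP) : ValiantsHypothesis := by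
  show VP ℂ ≠ VNP ℂ
  exact fun hEq => h (polylogWidthVP_of_VP_eq_VNP hEq)

end OrbitRestorationLinearVolumeQPVHStrength

end Summit.ValiantsHypothesis.ValiantsHypothesis.Theorems

end
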